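import Literature.Probability.RandomPlanarGeometry.LoewnerRemainingHull
import Literature.Probability.RandomPlanarGeometry.SLEImageLocalisation
import Literature.Probability.RandomPlanarGeometry.LoewnerAliveMargin
import Literature.Probability.RandomPlanarGeometry.StarHullClusters
import Literature.Probability.RandomPlanarGeometry.StarHullClopenPiece
import HarnessLib

/-!
# The through-swallow image chain of SLE₆: the piece structure (definitions)

Topic `Probability/RandomPlanarGeometry`; definitions with bodies + structural lemmas. In the proof of the
locality of chordal SLE₆ with respect to a `*`-hull `A` in the neighbourhood form (Lawler–Schramm–Werner
(2001) Thm. 2.2; G. F. Lawler (2005) §6.3 Thm. 6.13) the conformal image is followed THROUGH the finitely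
many instants at which the hull swallows whole `δ`-clusters of `A` (`StarHullClusters`,
`LoewnerClusterSwallow`, `LoewnerRemainingHull`). This file organises the bookkeeping of those instants.

* `clusterFinset hA hδ` — the finite family `𝒬` of `δ`-clusters of `A` (nonempty `*`-hulls partitioning `A`);
* `pieceHull A s = A ∖ ⋃ s` (`s ⊆ 𝒬`) — the finitely many candidate remaining hulls (`*`-hulls, nonempty
  iff `s ≠ 𝒬`);
* `Loewner.pieceStart W s = max_{Q ∈ s} T_Q`, `Loewner.pieceEnd W 𝒬 s = min_{Q ∉ s} T_Q` (`T_Q` the hull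
  hitting time of the cluster `Q`), `Loewner.swallowedAt W 𝒬 u = {Q | T_Q ≤ u}`: the piece of `s` is the
  time interval `[a_s, b_s) = {u | swallowedAt u = s}` (`pieceStart_le_and_lt_pieceEnd_iff`), `b_s` is the
  hull hitting time of `pieceHull A s` (`pieceEnd_eq_hullHitTime`), and under the cluster dichotomy
  ("every cluster is inside `K̂_u` or disjoint from it") the remaining hull `remHull W A u` IS the piece hull
  of the swallowed family (`remHull_eq_pieceHull_swallowedAt`), in particular closed;
* on the Wiener space (`W = drvK κ (brownianCPath ω)`): the piece times before a horizon `H`,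
  `thrRho = (a_s ∧ b_s) ∧ H ≤ thrSigma = b_s ∧ H`, the level-`n` piece martingales `pieceMart` (the localised
  image driving process `imgMartK` of the piece hull, `SLEImageLocalisation`; the driver itself for `s = 𝒬`)
  with their clocks `pieceClock`, the piece increments `pieceIncr`, `pieceClockIncr`, and the level-`n`
  approximations `thrLevelSum`, `thrLevelBracket` of the stopped through-swallow driving process
  `thrDrv = thrImageDriver − L_A` and of its compensated square.

## References

* G. F. Lawler, O. Schramm, W. Werner, Acta Math. **187** (2001), Thm. 2.2. [LawlerSchrammWerner2001]
* G. F. Lawler, *Conformally Invariant Processes in the Plane* (2005), §6.3 Thm. 6.13. [Lawler2005]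
* [LSW] 2003, §5. [LawlerSchrammWerner2003Restriction]
-/

noncomputable section

open Set Filter Metric Function MeasureTheory
open _root_.Complex _root_.Topology
open scoped NNReal

namespace Literature.Probability.RandomPlanarGeometry

/-! ### The finite family of `δ`-clusters of a `*`-hull -/

section Clusters

variable {A : Set ℂ} {δ : ℝ}

/-- The finite family of the `δ`-clusters of the `*`-hull `A` (`finite_setOf_deltaCluster`). [folklore] -/
def clusterFinset (hA : IsStarHull A) (hδ : 0 < δ) : Finset (Set ℂ) :=
  (finite_setOf_deltaCluster hA.isBoundedHull.isCompact hδ).toFinset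

variable (hA : IsStarHull A) (hδ : 0 < δ)

/-- Membership in the cluster family. [folklore] -/
theorem mem_clusterFinset {Q : Set ℂ} : Q ∈ clusterFinset hA hδ ↔ ∃ a ∈ A, Q = deltaCluster A δ a := by
  rw [clusterFinset, Set.Finite.mem_toFinset]; rfl

/-- The cluster of a point of `A` belongs to the family. [folklore] -/
theorem deltaCluster_mem_clusterFinset {a : ℂ} (ha : a ∈ A) : deltaCluster A δ a ∈ clusterFinset hA hδ :=
  (mem_clusterFinset hA hδ).2 ⟨a, ha, rfl⟩

/-- Every cluster is a nonempty closed subset of `A` with closed complement in `A`, hence a nonempty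
`*`-hull (`IsStarHull.isStarHull_piece`). [folklore] -/
theorem clusterFinset_spec {Q : Set ℂ} (hQ : Q ∈ clusterFinset hA hδ) :
    Q ⊆ A ∧ Q.Nonempty ∧ IsClosed Q ∧ IsClosed (A \ Q) ∧ IsStarHull Q := by
  obtain ⟨a, ha, rfl⟩ := (mem_clusterFinset hA hδ).1 hQ
  have hAc := hA.isBoundedHull.isClosed
  exact ⟨deltaCluster_subset ha, ⟨a, mem_deltaCluster_self A δ a⟩, isClosed_deltaCluster hAc hδ ha,
    isClosed_diff_deltaCluster hAc hδ ha,
    hA.isStarHull_piece (deltaCluster_subset ha) (isClosed_deltaCluster hAc hδ ha) (isClosed_diff_deltaCluster hAc hδ ha)⟩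

/-- Two clusters of the family that meet are equal. [folklore] -/
theorem eq_of_mem_clusterFinset_of_mem {Q Q' : Set ℂ} (hQ : Q ∈ clusterFinset hA hδ) (hQ' : Q' ∈ clusterFinset hA hδ)
    {z : ℂ} (hz : z ∈ Q) (hz' : z ∈ Q') : Q = Q' := by
  obtain ⟨a, -, rfl⟩ := (mem_clusterFinset hA hδ).1 hQ
  obtain ⟨a', -, rfl⟩ := (mem_clusterFinset hA hδ).1 hQ'
  rw [← deltaCluster_eq_of_mem hz, ← deltaCluster_eq_of_mem hz']

/-- Distinct clusters of the family are disjoint. [folklore] -/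
theorem disjoint_of_mem_clusterFinset {Q Q' : Set ℂ} (hQ : Q ∈ clusterFinset hA hδ) (hQ' : Q' ∈ clusterFinset hA hδ)
    (hne : Q ≠ Q') : Disjoint Q Q' :=
  Set.disjoint_left.2 fun _ hz hz' ↦ hne (eq_of_mem_clusterFinset_of_mem hA hδ hQ hQ' hz hz')

/-- The clusters cover `A`. [folklore] -/
theorem biUnion_clusterFinset : ⋃ Q ∈ clusterFinset hA hδ, Q = A := by
  refine Subset.antisymm (iUnion₂_subset fun Q hQ ↦ (clusterFinset_spec hA hδ hQ).1) fun a ha ↦ ?_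
  exact mem_iUnion₂.2 ⟨deltaCluster A δ a, deltaCluster_mem_clusterFinset hA hδ ha, mem_deltaCluster_self A δ a⟩

end Clusters

/-! ### The piece hulls `A ∖ ⋃ s` -/

section Pieces

variable {A : Set ℂ} {δ : ℝ}

/-- The **piece hull** `A ∖ ⋃ s` left when the clusters in `s` have been swallowed. [folklore] -/
def pieceHull (A : Set ℂ) (s : Finset (Set ℂ)) : Set ℂ := A \ ⋃ Q ∈ s, Q

variable (hA : IsStarHull A) (hδ : 0 < δ)

/-- The piece hull is part of `A`. [folklore] -/
theorem pieceHull_subset (A : Set ℂ) (s : Finset (Set ℂ)) : pieceHull A s ⊆ A := sdiff_subset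

/-- The piece hull is the union of the remaining clusters. [folklore] -/
theorem pieceHull_eq_biUnion {s : Finset (Set ℂ)} (hs : s ⊆ clusterFinset hA hδ) :
    pieceHull A s = ⋃ Q ∈ clusterFinset hA hδ \ s, Q := by
  ext z
  rw [pieceHull, Set.mem_sdiff, mem_iUnion₂, mem_iUnion₂]
  constructor
  · rintro ⟨hzA, hz⟩
    exact ⟨deltaCluster A δ z, Finset.mem_sdiff.2 ⟨deltaCluster_mem_clusterFinset hA hδ hzA,
      fun h ↦ hz ⟨_, h, mem_deltaCluster_self A δ z⟩⟩, mem_deltaCluster_self A δ z⟩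
  · rintro ⟨Q, hQ, hzQ⟩
    obtain ⟨hQ𝒬, hQs⟩ := Finset.mem_sdiff.1 hQ
    refine ⟨(clusterFinset_spec hA hδ hQ𝒬).1 hzQ, ?_⟩
    rintro ⟨Q', hQ', hzQ'⟩
    exact hQs (by rwa [eq_of_mem_clusterFinset_of_mem hA hδ hQ𝒬 (hs hQ') hzQ hzQ'])

/-- **The piece hulls are `*`-hulls** (clopen pieces of `A`). [folklore] -/
theorem isStarHull_pieceHull {s : Finset (Set ℂ)} (hs : s ⊆ clusterFinset hA hδ) : IsStarHull (pieceHull A s) := by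
  have hU : IsClosed (⋃ Q ∈ s, Q) :=
    Set.Finite.isClosed_biUnion s.finite_toSet fun Q hQ ↦ (clusterFinset_spec hA hδ (hs hQ)).2.2.1
  have h1 : IsClosed (pieceHull A s) := by
    rw [pieceHull_eq_biUnion hA hδ hs]
    exact Set.Finite.isClosed_biUnion (clusterFinset hA hδ \ s).finite_toSet fun Q hQ ↦
      (clusterFinset_spec hA hδ (Finset.mem_sdiff.1 hQ).1).2.2.1
  have h2 : IsClosed (A \ pieceHull A s) := by
    rw [pieceHull, Set.sdiff_sdiff_right_self]
    exact hA.isBoundedHull.isClosed.inter hU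
  exact hA.isStarHull_piece (pieceHull_subset A s) h1 h2

/-- A proper subfamily leaves a nonempty piece. [folklore] -/
theorem pieceHull_nonempty {s : Finset (Set ℂ)} (hs : s ⊆ clusterFinset hA hδ) (hne : s ≠ clusterFinset hA hδ) :
    (pieceHull A s).Nonempty := by
  obtain ⟨Q, hQ, hQs⟩ := Finset.exists_of_ssubset (lt_of_le_of_ne hs hne)
  obtain ⟨z, hz⟩ := (clusterFinset_spec hA hδ hQ).2.1
  rw [pieceHull_eq_biUnion hA hδ hs]
  exact ⟨z, mem_iUnion₂.2 ⟨Q, Finset.mem_sdiff.2 ⟨hQ, hQs⟩, hz⟩⟩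

/-- Swallowing every cluster leaves nothing. [folklore] -/
theorem pieceHull_clusterFinset : pieceHull A (clusterFinset hA hδ) = ∅ := by
  rw [pieceHull, biUnion_clusterFinset hA hδ, sdiff_self]

/-- The whole of `A` is the piece of the empty subfamily. [folklore] -/
@[simp] theorem pieceHull_empty (A : Set ℂ) : pieceHull A ∅ = A := by simp [pieceHull]

end Pieces


/-! ### The piece times of a driving function -/

namespace Loewner

variable {W : ℝ≥0 → ℝ} {A : Set ℂ} {δ : ℝ}

/-- Two extended times with the same strict lower sets of finite times are equal. [folklore] -/
theorem WithTop.eq_of_forall_coe_lt_iff {x y : WithTop ℝ≥0} (h : ∀ u : ℝ≥0, (u : WithTop ℝ≥0) < x ↔ (u : WithTop ℝ≥0) < y) :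
    x = y := by
  by_contra hne
  wlog hlt : x < y generalizing x y
  · exact this (fun u ↦ (h u).symm) (Ne.symm hne) (lt_of_le_of_ne (not_lt.1 hlt) (Ne.symm hne))
  obtain ⟨x', rfl⟩ := WithTop.ne_top_iff_exists.1 hlt.ne_top
  exact lt_irrefl _ ((h x').2 hlt)

/-- The **start** `a_s = max_{Q ∈ s} T_Q` of the piece indexed by `s` (`⊥ = 0` for `s = ∅`). [folklore] -/
def pieceStart (W : ℝ≥0 → ℝ) (s : Finset (Set ℂ)) : WithTop ℝ≥0 := s.sup fun Q ↦ hullHitTime W Q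

/-- The **end** `b_s = min_{Q ∉ s} T_Q` of the piece indexed by `s` (`⊤` for `s = 𝒬`). [folklore] -/
def pieceEnd (W : ℝ≥0 → ℝ) (𝒬 s : Finset (Set ℂ)) : WithTop ℝ≥0 := (𝒬 \ s).inf fun Q ↦ hullHitTime W Q

/-- The clusters swallowed (equivalently: touched) by time `u`. [folklore] -/
def swallowedAt (W : ℝ≥0 → ℝ) (𝒬 : Finset (Set ℂ)) (u : ℝ≥0) : Finset (Set ℂ) :=
  𝒬.filter fun Q ↦ hullHitTime W Q ≤ u

/-- The swallowed family is a subfamily. [folklore] -/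
theorem swallowedAt_subset (W : ℝ≥0 → ℝ) (𝒬 : Finset (Set ℂ)) (u : ℝ≥0) : swallowedAt W 𝒬 u ⊆ 𝒬 :=
  Finset.filter_subset _ _

/-- The swallowed family increases with time. [folklore] -/
theorem swallowedAt_mono (W : ℝ≥0 → ℝ) (𝒬 : Finset (Set ℂ)) {u v : ℝ≥0} (huv : u ≤ v) :
    swallowedAt W 𝒬 u ⊆ swallowedAt W 𝒬 v := fun Q hQ ↦ by
  rw [swallowedAt, Finset.mem_filter] at hQ ⊢
  exact ⟨hQ.1, hQ.2.trans (WithTop.coe_le_coe.2 huv)⟩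

/-- **The piece of `s` is the level set `{u | swallowedAt u = s}`**: `a_s ≤ u < b_s ↔ swallowedAt u = s`. [folklore] -/
theorem pieceStart_le_and_lt_pieceEnd_iff {𝒬 s : Finset (Set ℂ)} (hs : s ⊆ 𝒬) {u : ℝ≥0} :
    pieceStart W s ≤ u ∧ (u : WithTop ℝ≥0) < pieceEnd W 𝒬 s ↔ swallowedAt W 𝒬 u = s := by
  rw [pieceStart, Finset.sup_le_iff, pieceEnd, Finset.lt_inf_iff (WithTop.coe_lt_top u)]
  constructor
  · rintro ⟨h1, h2⟩
    ext Q
    rw [swallowedAt, Finset.mem_filter]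
    constructor
    · rintro ⟨hQ, hQu⟩
      by_contra hQs
      exact (h2 Q (Finset.mem_sdiff.2 ⟨hQ, hQs⟩)).not_ge hQu
    · exact fun hQs ↦ ⟨hs hQs, h1 Q hQs⟩
  · rintro rfl
    refine ⟨fun Q hQ ↦ (Finset.mem_filter.1 hQ).2, fun Q hQ ↦ ?_⟩
    obtain ⟨hQ𝒬, hQs⟩ := Finset.mem_sdiff.1 hQ
    rw [swallowedAt, Finset.mem_filter, not_and] at hQs
    exact not_le.1 (hQs hQ𝒬)

/-- In particular `u` lies in the piece of `swallowedAt u`. [folklore] -/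
theorem pieceStart_le_and_lt_pieceEnd_swallowedAt (𝒬 : Finset (Set ℂ)) (u : ℝ≥0) :
    pieceStart W (swallowedAt W 𝒬 u) ≤ u ∧ (u : WithTop ℝ≥0) < pieceEnd W 𝒬 (swallowedAt W 𝒬 u) :=
  (pieceStart_le_and_lt_pieceEnd_iff (swallowedAt_subset W 𝒬 u)).2 rfl

/-- **The end of the piece of `s` is the hull hitting time of the piece hull** `A ∖ ⋃ s`. [folklore] -/
theorem pieceEnd_eq_hullHitTime (hW : Continuous W) (hA : IsStarHull A) (hδ : 0 < δ) {s : Finset (Set ℂ)} (hs : s ⊆ clusterFinset hA hδ) :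
    pieceEnd W (clusterFinset hA hδ) s = hullHitTime W (pieceHull A s) := by
  refine WithTop.eq_of_forall_coe_lt_iff fun u ↦ ?_
  rw [pieceEnd, Finset.lt_inf_iff (WithTop.coe_lt_top u)]
  rcases eq_or_ne s (clusterFinset hA hδ) with rfl | hne
  · simp only [Finset.sdiff_self, Finset.notMem_empty, IsEmpty.forall_iff, implies_true, true_iff,
      pieceHull_clusterFinset]
    rw [hullHitTime_eq_top_iff.2 fun t ↦ disjoint_empty _]
    exact WithTop.coe_lt_top u
  rw [← disjoint_closedHull_iff_lt_hullHitTime hW (isStarHull_pieceHull hA hδ hs) (pieceHull_nonempty hA hδ hs hne),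
    pieceHull_eq_biUnion hA hδ hs, Set.disjoint_iUnion₂_right]
  refine forall₂_congr fun Q hQ ↦ ?_
  obtain ⟨-, hQne, -, -, hQ⟩ := clusterFinset_spec hA hδ (Finset.mem_sdiff.1 hQ).1
  exact (disjoint_closedHull_iff_lt_hullHitTime hW hQ hQne).symm

/-- The remaining hull always contains the piece hull of the swallowed family. [folklore] -/
theorem pieceHull_swallowedAt_subset_remHull (hA : IsStarHull A) (hδ : 0 < δ) (W : ℝ≥0 → ℝ) (u : ℝ≥0) :
    pieceHull A (swallowedAt W (clusterFinset hA hδ) u) ⊆ remHull W A u := by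
  intro z hz
  rw [pieceHull_eq_biUnion hA hδ (swallowedAt_subset _ _ _)] at hz
  obtain ⟨Q, hQ, hzQ⟩ := mem_iUnion₂.1 hz
  obtain ⟨hQ𝒬, hQs⟩ := Finset.mem_sdiff.1 hQ
  obtain ⟨hQA, hQne, -, -, hQh⟩ := clusterFinset_spec hA hδ hQ𝒬
  rw [swallowedAt, Finset.mem_filter, not_and, not_le] at hQs
  exact ⟨hQA hzQ, fun hzK ↦ Set.disjoint_left.1 (disjoint_closedHull_of_lt_hullHitTime (hQs hQ𝒬)) hzK hzQ⟩

/-- **Under the cluster dichotomy at time `u`, the remaining hull is the piece hull of the swallowed family.**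
[cite: Lawler2005, §6.3 Thm. 6.13] -/
theorem remHull_eq_pieceHull_swallowedAt (hW : Continuous W) (hA : IsStarHull A) (hδ : 0 < δ) {u : ℝ≥0}
    (hclw : ∀ a ∈ A, deltaCluster A δ a ⊆ closedHull W u ∨ Disjoint (deltaCluster A δ a) (closedHull W u)) :
    remHull W A u = pieceHull A (swallowedAt W (clusterFinset hA hδ) u) := by
  refine Subset.antisymm (fun z hz ↦ ?_) (pieceHull_swallowedAt_subset_remHull hA hδ W u)
  refine ⟨hz.1, fun hzU ↦ ?_⟩
  obtain ⟨Q, hQ, hzQ⟩ := mem_iUnion₂.1 hzU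
  obtain ⟨hQ𝒬, hQu⟩ := Finset.mem_filter.1 hQ
  obtain ⟨a, ha, rfl⟩ := (mem_clusterFinset hA hδ).1 hQ𝒬
  obtain ⟨-, hQne, -, -, hQh⟩ := clusterFinset_spec hA hδ hQ𝒬
  have hdead : ¬ Disjoint (closedHull W u) (deltaCluster A δ a) := fun h ↦
    (lt_hullHitTime_of_disjoint hW hQh hQne h).not_ge hQu
  rcases hclw a ha with h | h
  · exact hz.2 (h hzQ)
  · exact hdead h.symm

/-- Under the cluster dichotomy the remaining hull is closed. [folklore] -/
theorem isClosed_remHull_of_clusterwise (hW : Continuous W) (hA : IsStarHull A) (hδ : 0 < δ) {u : ℝ≥0}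
    (hclw : ∀ a ∈ A, deltaCluster A δ a ⊆ closedHull W u ∨ Disjoint (deltaCluster A δ a) (closedHull W u)) :
    IsClosed (remHull W A u) := by
  rw [remHull_eq_pieceHull_swallowedAt hW hA hδ hclw]
  exact (isStarHull_pieceHull hA hδ (swallowedAt_subset _ _ _)).isBoundedHull.isClosed

/-- **A swallowed cluster stays inside the later closed hulls**: if `T_Q ≤ u` and the dichotomy holds at `u`,
then `Q ⊆ K̂_v` for `v ≥ u`. [folklore] -/
theorem subset_closedHull_of_hullHitTime_le (hW : Continuous W) (hA : IsStarHull A) (hδ : 0 < δ) {Q : Set ℂ} (hQ : Q ∈ clusterFinset hA hδ) {u v : ℝ≥0}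
    (hQu : hullHitTime W Q ≤ u) (huv : u ≤ v)
    (hclw : ∀ a ∈ A, deltaCluster A δ a ⊆ closedHull W u ∨ Disjoint (deltaCluster A δ a) (closedHull W u)) :
    Q ⊆ closedHull W v := by
  obtain ⟨a, ha, rfl⟩ := (mem_clusterFinset hA hδ).1 hQ
  obtain ⟨-, hQne, -, -, hQh⟩ := clusterFinset_spec hA hδ hQ
  rcases hclw a ha with h | h
  · exact h.trans (closedHull_mono W huv)
  · exact absurd h.symm fun h' ↦ (lt_hullHitTime_of_disjoint hW hQh hQne h').not_ge hQu

/-- **The remaining hull at the end of a piece**: if the piece of `s` has started by the time `u ≤ τ`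
(`a_s ≤ u`, dichotomy at `u`), then `remHull W A τ = pieceHull A s ∖ K̂_τ`. [folklore] -/
theorem remHull_eq_pieceHull_diff (hW : Continuous W) (hA : IsStarHull A) (hδ : 0 < δ) {s : Finset (Set ℂ)} (hs : s ⊆ clusterFinset hA hδ) {u τ : ℝ≥0}
    (hsu : pieceStart W s ≤ u) (huτ : u ≤ τ)
    (hclw : ∀ a ∈ A, deltaCluster A δ a ⊆ closedHull W u ∨ Disjoint (deltaCluster A δ a) (closedHull W u)) :
    remHull W A τ = pieceHull A s \ closedHull W τ := by
  rw [pieceStart, Finset.sup_le_iff] at hsu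
  have hU : (⋃ Q ∈ s, Q) ⊆ closedHull W τ :=
    iUnion₂_subset fun Q hQ ↦ subset_closedHull_of_hullHitTime_le hW hA hδ (hs hQ) (hsu Q hQ) huτ hclw
  rw [remHull, pieceHull, Set.sdiff_sdiff, union_eq_self_of_subset_left hU]

end Loewner

/-! ### The random piece times and the level-`n` piece processes on the Wiener space -/

section Random

variable (κ : ℝ≥0) {A : Set ℂ} (hA : IsStarHull A) {δ : ℝ} (hδ : 0 < δ) (H : (ℝ≥0 → ℝ) → WithTop ℝ≥0)

/-- The **start of the piece of `s` before the horizon**: `ρ_s = (a_s ∧ b_s) ∧ H`. [folklore] -/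
def thrRho (s : Finset (Set ℂ)) (ω : ℝ≥0 → ℝ) : WithTop ℝ≥0 :=
  min (min (Loewner.pieceStart (drvK κ (brownianCPath ω)) s)
    (Loewner.pieceEnd (drvK κ (brownianCPath ω)) (clusterFinset hA hδ) s)) (H ω)

/-- The **end of the piece of `s` before the horizon**: `σ_s = b_s ∧ H`. [folklore] -/
def thrSigma (s : Finset (Set ℂ)) (ω : ℝ≥0 → ℝ) : WithTop ℝ≥0 :=
  min (Loewner.pieceEnd (drvK κ (brownianCPath ω)) (clusterFinset hA hδ) s) (H ω)

open Classical in
/-- The **level-`n` martingale of the piece of `s`**: the localised image driving process `imgMartK` of the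
piece hull `A ∖ ⋃ s` (a nonempty `*`-hull) for a proper subfamily, the driving function itself once every
cluster is swallowed. [cite: LawlerSchrammWerner2001, Thm. 2.2] -/
def pieceMart (s : Finset (Set ℂ)) (n : ℕ) : ℝ≥0 → (ℝ≥0 → ℝ) → ℝ :=
  if h : s ⊆ clusterFinset hA hδ ∧ s ≠ clusterFinset hA hδ then
    imgMartK κ (isStarHull_pieceHull hA hδ h.1) (pieceHull_nonempty hA hδ h.1 h.2) n
  else fun t ω ↦ drvK κ (brownianCPath ω) t

open Classical in
/-- The **level-`n` clock of the piece of `s`**: `imgClockK` of the piece hull, the identity clock once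
every cluster is swallowed. [cite: LawlerSchrammWerner2003Restriction, §5 (5.1)] -/
def pieceClock (s : Finset (Set ℂ)) (n : ℕ) : ℝ≥0 → (ℝ≥0 → ℝ) → ℝ :=
  if h : s ⊆ clusterFinset hA hδ ∧ s ≠ clusterFinset hA hδ then
    imgClockK κ (isStarHull_pieceHull hA hδ h.1) (pieceHull_nonempty hA hδ h.1 h.2) n
  else fun t _ ↦ (t : ℝ)

/-- The **level-`n` increment of the piece of `s`**: `M^{s,n}_{t ∧ σ_s} − M^{s,n}_{t ∧ ρ_s}`. [folklore] -/
def pieceIncr (s : Finset (Set ℂ)) (n : ℕ) (t : ℝ≥0) (ω : ℝ≥0 → ℝ) : ℝ :=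
  stoppedProcess (pieceMart κ hA hδ s n) (thrSigma κ hA hδ H s) t ω -
    stoppedProcess (pieceMart κ hA hδ s n) (thrRho κ hA hδ H s) t ω

/-- The level-`n` clock increment of the piece of `s`. [folklore] -/
def pieceClockIncr (s : Finset (Set ℂ)) (n : ℕ) (t : ℝ≥0) (ω : ℝ≥0 → ℝ) : ℝ :=
  stoppedProcess (pieceClock κ hA hδ s n) (thrSigma κ hA hδ H s) t ω -
    stoppedProcess (pieceClock κ hA hδ s n) (thrRho κ hA hδ H s) t ω

/-- The **level-`n` approximation of the stopped through-swallow driving process**: the sum of the piece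
increments over all subfamilies of clusters. [folklore] -/
def thrLevelSum (n : ℕ) (t : ℝ≥0) (ω : ℝ≥0 → ℝ) : ℝ :=
  ∑ s ∈ (clusterFinset hA hδ).powerset, pieceIncr κ hA hδ H s n t ω

/-- The **level-`n` approximation of the compensated square** `(U)² − 6 σ` of the stopped through-swallow
driving process: `∑_s ((G_s)² − 6 ΔC_s + 2 U_{ρ_s} G_s)`. [folklore] -/
def thrLevelBracket (n : ℕ) (t : ℝ≥0) (ω : ℝ≥0 → ℝ) : ℝ :=
  ∑ s ∈ (clusterFinset hA hδ).powerset, (pieceIncr κ hA hδ H s n t ω ^ 2 - 6 * pieceClockIncr κ hA hδ H s n t ω +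
    2 * stoppedValue (thrLevelSum κ hA hδ H n) (thrRho κ hA hδ H s) ω * pieceIncr κ hA hδ H s n t ω)

/-- The **through-swallow driving process minus `L_A`**: `X_t = U*_t − L_A = W_t − L_{B_t}`. [folklore] -/
def thrDrv (κ : ℝ≥0) (A : Set ℂ) (t : ℝ≥0) (ω : ℝ≥0 → ℝ) : ℝ :=
  Loewner.thrImageDriver (drvK κ (brownianCPath ω)) A t - (starShift A).re

variable {κ hA hδ H}

/-- `ρ_s ≤ σ_s`. [folklore] -/
theorem thrRho_le_thrSigma (s : Finset (Set ℂ)) (ω : ℝ≥0 → ℝ) : thrRho κ hA hδ H s ω ≤ thrSigma κ hA hδ H s ω :=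
  min_le_min_right _ (min_le_right _ _)

/-- `σ_s ≤ H`. [folklore] -/
theorem thrSigma_le (s : Finset (Set ℂ)) (ω : ℝ≥0 → ℝ) : thrSigma κ hA hδ H s ω ≤ H ω := min_le_right _ _

/-- `ρ_s ≤ H`. [folklore] -/
theorem thrRho_le (s : Finset (Set ℂ)) (ω : ℝ≥0 → ℝ) : thrRho κ hA hδ H s ω ≤ H ω := min_le_right _ _

/-- Unfolding of `pieceMart` for a proper subfamily. [folklore] -/
theorem pieceMart_of_ne {s : Finset (Set ℂ)} (hs : s ⊆ clusterFinset hA hδ) (hne : s ≠ clusterFinset hA hδ) (n : ℕ) :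
    pieceMart κ hA hδ s n = imgMartK κ (isStarHull_pieceHull hA hδ hs) (pieceHull_nonempty hA hδ hs hne) n := by
  rw [pieceMart, dif_pos ⟨hs, hne⟩]

/-- Unfolding of `pieceMart` for the full family. [folklore] -/
theorem pieceMart_clusterFinset (n : ℕ) :
    pieceMart κ hA hδ (clusterFinset hA hδ) n = fun t ω ↦ drvK κ (brownianCPath ω) t := by
  rw [pieceMart, dif_neg (fun h ↦ h.2 rfl)]

/-- Unfolding of `pieceClock` for a proper subfamily. [folklore] -/
theorem pieceClock_of_ne {s : Finset (Set ℂ)} (hs : s ⊆ clusterFinset hA hδ) (hne : s ≠ clusterFinset hA hδ) (n : ℕ) :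
    pieceClock κ hA hδ s n = imgClockK κ (isStarHull_pieceHull hA hδ hs) (pieceHull_nonempty hA hδ hs hne) n := by
  rw [pieceClock, dif_pos ⟨hs, hne⟩]

/-- Unfolding of `pieceClock` for the full family. [folklore] -/
theorem pieceClock_clusterFinset (n : ℕ) : pieceClock κ hA hδ (clusterFinset hA hδ) n = fun (t : ℝ≥0) _ ↦ (t : ℝ) := by
  rw [pieceClock, dif_neg (fun h ↦ h.2 rfl)]

end Random

end Literature.Probability.RandomPlanarGeometry

end
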